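import Literature.NumberTheory.LFunctions.PolynomialRootMertensFirst
import Literature.NumberTheory.Sieve.AletheiaZomleferFukshanskyGarcia2020ApplicationsBrunSieveProofs
import Literature.NumberTheory.Sieve.DiamondHalberstamTwoLinearSetup
import Literature.NumberTheory.Sieve.SieveFunctions
import HarnessLib

/-!
# Every Bateman–Horn system is a sieve problem of dimension `k` (Iwaniec's `Ω(k, L)`)

Topic `Literature/NumberTheory/Sieve` (next to `BatemanHornMertensProduct.lean`,
`PolynomialValuesSieveSequence.lean`, `SieveFunctions.lean`). Everything in this file is PROVED
(theorems only: no named fact, no new definition, no `sorry`).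

Let `f = (f₁, …, f_k)` be a Bateman–Horn system of integer polynomials (`IsBatemanHornSystem f`:
irreducible, positive leading coefficients, pairwise non-associated, no fixed prime divisor of
`F = ∏ fᵢ`) and `ω_f(p) = #{n mod p : p ∣ F(n)}` (`polyRootCountMod f p =
polyRootCountMod ![∏ i, f i] p`, `PolyPrimeCountBrun.polyRootCountMod_eq_single_prod`). The sieve
density of the sequence of values `F(n)` is `p ↦ ω_f(p)/p` (the tree's `rootDensity (∏ i, f i)`).
Diamond–Halberstam–Galway, *A Higher-Dimensional Sieve Method*, Definition 1.3 (1.5), call a sieve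
problem of dimension `κ` (condition `Ω(κ)`) when
`∏_{w₁ ≤ p < w} (1 − ω(p)/p)⁻¹ ≤ (log w/log w₁)^κ (1 + A/log w₁)` for `2 ≤ w₁ < w`; this is the
tree's `HasIwaniecDimension (density) κ A` (Iwaniec's `Ω(κ, L)`). In Example 5.8 (prime values of
polynomials) they record: "`∑_{p ≤ x} ρ(p) log p/p = g log x + O_H(1)`, and therefore `𝒜` satisfies
`Ω(g)`" — by the prime ideal theorem. This file proves that statement for every Bateman–Horn
system, over the tree's definitions:

* `BatemanHornDimension.exists_abs_sum_rootCount_mul_log_sub_self_le` — Chebyshev with rate for the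
  roots of ONE irreducible `g` of positive degree and arbitrary leading coefficient:
  `|∑_{p ≤ t} ρ_g(p) log p − t| ≤ C t/log t` (`t ≥ 2`) (from the tree's monic case
  `DegreeOnePrimes.abs_sum_primesLE_rootCount_mul_log_sub_self_le_logPow`, Landau's prime ideal
  theorem through Dedekind–Kummer, by passing to the integral normalization);
* `BatemanHornDimension.exists_mertens_rootCount` — Mertens' theorem with rate for `ρ_g`:
  `|∑_{p ≤ x} ρ_g(p)/p − log log x − c_g| ≤ C_g/log x` (`x ≥ 2`);
* `BatemanHornDimension.sum_window_le_of_mertens` — for any weight `a(p)` obeying Mertens' theorem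
  with rate, `∑_{w ≤ p < z} a(p)/p ≤ log log z − log log w + C₁/log w` (`2 ≤ w ≤ z`);
* `BatemanHornDimension.exists_sum_window_rootCount_le` — for a system,
  `∑_{w ≤ p < z} ω_f(p)/p ≤ k (log log z − log log w) + C₁/log w` (union bound `ω_f ≤ ∑ ρᵢ`);
* **`IsBatemanHornSystem.exists_hasIwaniecDimension`** — for every Bateman–Horn system `f` of `k`
  polynomials there is `L` with `HasIwaniecDimension (rootDensity (∏ i, f i)) k L`; and the
  one-polynomial case `IsBatemanHornSystem.exists_hasIwaniecDimension_single`
  (`HasIwaniecDimension (rootDensity g) 1 L`).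

## References
* H. G. Diamond, H. Halberstam, W. F. Galway, *A Higher-Dimensional Sieve Method*, Cambridge Tracts
  in Mathematics 177, CUP (2008): §1.4 Definition 1.3 (1.5) (PDF p. 17); §5.4 Example 5.8 (PDF
  p. 51–52, "and therefore `𝒜` satisfies `Ω(g)`"). [DiamondHalberstamGalway2008]
* H. Iwaniec, *Rosser's sieve*, Acta Arith. 36 (1980), (1.2) (the condition `Ω(κ, L)`).
* E. Landau, Math. Ann. 56 (1903) (prime ideal theorem; Mertens for prime ideals).
-/

open Finset Real Polynomial

namespace Literature.NumberTheory.Sieve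

namespace BatemanHornDimension

open Literature.NumberTheory.LFunctions

/-! ### Chebyshev and Mertens with rate for the roots of one irreducible polynomial -/

/-- **Chebyshev's estimate with rate for the roots of an irreducible polynomial of positive degree
and arbitrary leading coefficient**: `|∑_{p ≤ t} ρ_g(p) log p − t| ≤ C t/log t` for `t ≥ 2`
(the monic case is Landau's prime ideal theorem for `ℚ[X]/(g)` through Dedekind–Kummer, tree
`DegreeOnePrimes.abs_sum_primesLE_rootCount_mul_log_sub_self_le_logPow`; the general case passes to
the monic integral normalization `g₁`, `ρ_{g₁}(p) = ρ_g(p)` for `p ∤ lc g`, the primes `p ∣ lc g`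
costing at most `∑_{p ≤ |lc g|} p log p`). Stated in the input format of
`ThetaMertens.sum_primesLE_div_of_theta` (`dens = 1`, `A = 0`).
[cite: DiamondHalberstamGalway2008, §5.4 Example 5.8 (PDF p. 52)] -/
theorem exists_abs_sum_rootCount_mul_log_sub_self_le (g : ℤ[X]) (hirr : Irreducible g)
    (hdeg : 0 < g.natDegree) :
    ∃ C : ℝ, ∀ t : ℝ, 2 ≤ t →
      |∑ p ∈ Nat.primesLE ⌊t⌋₊, (polyRootCountMod ![g] p : ℝ) * Real.log p - 1 * t| ≤
        C * t / Real.log t ^ (0 + 1) := by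
  set g₁ : ℤ[X] := integralNormalization g with hg₁
  have hmon : g₁.Monic := monic_integralNormalization hirr.ne_zero
  have hirr₁ : Irreducible g₁ := irreducible_integralNormalization hirr hdeg
  obtain ⟨C, hC⟩ :=
    DegreeOnePrimes.abs_sum_primesLE_rootCount_mul_log_sub_self_le_logPow hmon hirr₁ 1
  set N : ℕ := g.leadingCoeff.natAbs with hN
  set E : ℝ := ∑ p ∈ Nat.primesLE N, (p : ℝ) * Real.log p with hE
  set ρ : ℕ → ℝ := fun p => (polyRootCountMod ![g] p : ℝ) with hρ
  set ρ₁ : ℕ → ℝ := fun p => (polyRootCountMod ![g₁] p : ℝ) with hρ₁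
  have hlc : g.leadingCoeff ≠ 0 := leadingCoeff_ne_zero.mpr hirr.ne_zero
  -- at a prime `p ∤ lc g` the two root counts agree
  have hagree : ∀ p : ℕ, p.Prime → ¬ p ∣ N → ρ p = ρ₁ p := by
    intro p hp hpN
    simp only [hρ, hρ₁, hg₁]
    rw [polyRootCountMod_integralNormalization hdeg hp]
    intro hdvd
    exact hpN (Int.natCast_dvd.mp hdvd)
  -- at every prime the difference of the terms is at most `p log p`
  have hterm : ∀ p : ℕ, p.Prime → |ρ p * Real.log p - ρ₁ p * Real.log p| ≤ p * Real.log p := by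
    intro p hp
    have hlog : 0 ≤ Real.log p := Real.log_natCast_nonneg p
    have h0 : 0 ≤ ρ p := Nat.cast_nonneg _
    have h1 : 0 ≤ ρ₁ p := Nat.cast_nonneg _
    have h2 : ρ p ≤ p := by
      simp only [hρ]
      exact_mod_cast polyRootCountMod_le ![g] p
    have h3 : ρ₁ p ≤ p := by
      simp only [hρ₁]
      exact_mod_cast polyRootCountMod_le ![g₁] p
    have hd : |ρ p - ρ₁ p| ≤ p := by
      rw [abs_le]
      constructor <;> linarith
    rw [← sub_mul, abs_mul, abs_of_nonneg hlog]
    exact mul_le_mul_of_nonneg_right hd hlog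
  have hE0 : 0 ≤ E := by
    refine sum_nonneg fun p _ => ?_
    have : 0 ≤ Real.log (p : ℝ) := Real.log_natCast_nonneg p
    positivity
  refine ⟨C + E, fun t ht => ?_⟩
  have hmain := hC t ht
  rw [Real.rpow_one] at hmain
  simp only [zero_add, pow_one, one_mul]
  have ht0 : 0 < t := by linarith
  have hlogt : 0 < Real.log t := Real.log_pos (by linarith)
  have hlogt_le : Real.log t ≤ t := (Real.log_le_sub_one_of_pos ht0).trans (by linarith)
  -- the monic sum is the `ρ₁`-sum
  have hsum₁ : ∑ p ∈ Nat.primesLE ⌊t⌋₊,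
      (#((range p).filter fun n : ℕ => (p : ℤ) ∣ g₁.eval (n : ℤ)) : ℝ) * Real.log p =
        ∑ p ∈ Nat.primesLE ⌊t⌋₊, ρ₁ p * Real.log p := by
    refine sum_congr rfl fun p _ => ?_
    simp only [hρ₁, polyRootCountMod_single]
  rw [hsum₁] at hmain
  -- the difference of the two sums is supported on the primes dividing `lc g`
  have hdiff : |(∑ p ∈ Nat.primesLE ⌊t⌋₊, ρ p * Real.log p) -
      ∑ p ∈ Nat.primesLE ⌊t⌋₊, ρ₁ p * Real.log p| ≤ E := by
    rw [← sum_sub_distrib]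
    have h1 : ∑ p ∈ Nat.primesLE ⌊t⌋₊, (ρ p * Real.log p - ρ₁ p * Real.log p) =
        ∑ p ∈ (Nat.primesLE ⌊t⌋₊).filter (fun p => p ∣ N),
          (ρ p * Real.log p - ρ₁ p * Real.log p) := by
      rw [sum_filter_of_ne]
      intro p hp hne
      by_contra hpN
      exact hne (by rw [hagree p (Nat.prime_of_mem_primesLE hp) hpN, sub_self])
    rw [h1]
    calc |∑ p ∈ (Nat.primesLE ⌊t⌋₊).filter (fun p => p ∣ N),
            (ρ p * Real.log p - ρ₁ p * Real.log p)|
        ≤ ∑ p ∈ (Nat.primesLE ⌊t⌋₊).filter (fun p => p ∣ N),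
            |ρ p * Real.log p - ρ₁ p * Real.log p| := abs_sum_le_sum_abs _ _
      _ ≤ ∑ p ∈ (Nat.primesLE ⌊t⌋₊).filter (fun p => p ∣ N), (p : ℝ) * Real.log p :=
          sum_le_sum fun p hp => hterm p (Nat.prime_of_mem_primesLE (mem_filter.mp hp).1)
      _ ≤ E := by
          refine sum_le_sum_of_subset_of_nonneg (fun p hp => ?_) fun p _ _ => ?_
          · obtain ⟨hp, hpN⟩ := mem_filter.mp hp
            exact Nat.mem_primesLE.mpr
              ⟨Nat.le_of_dvd (Int.natAbs_pos.mpr hlc) hpN, Nat.prime_of_mem_primesLE hp⟩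
          · have : 0 ≤ Real.log (p : ℝ) := Real.log_natCast_nonneg p
            positivity
  have hEt : E ≤ E * t / Real.log t := by
    rw [le_div_iff₀ hlogt]
    nlinarith [hE0, hlogt_le]
  have htri := abs_sub_le (∑ p ∈ Nat.primesLE ⌊t⌋₊, ρ p * Real.log p)
    (∑ p ∈ Nat.primesLE ⌊t⌋₊, ρ₁ p * Real.log p) t
  have e : (C + E) * t / Real.log t = C * t / Real.log t + E * t / Real.log t := by ring
  rw [e]
  linarith

/-- **Mertens' theorem with rate for the roots of an irreducible polynomial** (any leading
coefficient): for `g ∈ ℤ[X]` irreducible of positive degree there are `c_g` and `C_g ≥ 0` with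
`|∑_{p ≤ x} ρ_g(p)/p − (log log x + c_g)| ≤ C_g/log x` for all `x ≥ 2` (partial summation,
tree `ThetaMertens.sum_primesLE_div_of_theta`, on the Chebyshev estimate above — "by the Prime
Ideal Theorem"). [cite: DiamondHalberstamGalway2008, §5.4 Example 5.8 (PDF p. 52)] -/
theorem exists_mertens_rootCount (g : ℤ[X]) (hirr : Irreducible g) (hdeg : 0 < g.natDegree) :
    ∃ c C : ℝ, 0 ≤ C ∧ ∀ x : ℝ, 2 ≤ x →
      |∑ p ∈ Nat.primesLE ⌊x⌋₊, (polyRootCountMod ![g] p : ℝ) / p -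
          (Real.log (Real.log x) + c)| ≤ C / Real.log x := by
  obtain ⟨C₀, hθ⟩ := exists_abs_sum_rootCount_mul_log_sub_self_le g hirr hdeg
  obtain ⟨c, K, h⟩ := ThetaMertens.sum_primesLE_div_of_theta hθ
  refine ⟨c, max K 0, le_max_right _ _, fun x hx => ?_⟩
  have h1 := h x hx
  rw [zero_add, pow_one, one_mul] at h1
  exact h1.trans (div_le_div_of_nonneg_right (le_max_left _ _) (Real.log_pos (by linarith)).le)

/-! ### From Mertens with rate to the window bound -/

/-- The window `w ≤ p < z` of primes as a difference of initial segments: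
`{p < ⌈z⌉ : w ≤ p} = {p ≤ ⌈z⌉ − 1} \ {p ≤ ⌈w⌉ − 1}` (`w ≥ 1`). [folklore] -/
private theorem window_eq_sdiff {w z : ℝ} (hw : 1 ≤ w) (hwz : w ≤ z) :
    (Nat.primesBelow ⌈z⌉₊).filter (fun p : ℕ => w ≤ (p : ℝ)) =
      Nat.primesLE (⌈z⌉₊ - 1) \ Nat.primesLE (⌈w⌉₊ - 1) := by
  ext p
  simp only [mem_filter, Nat.mem_primesBelow, Finset.mem_sdiff, Nat.mem_primesLE]
  have hw1 : 1 ≤ ⌈w⌉₊ := Nat.one_le_ceil_iff.mpr (by linarith)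
  have hz1 : 1 ≤ ⌈z⌉₊ := Nat.one_le_ceil_iff.mpr (by linarith)
  constructor
  · rintro ⟨⟨hpz, hp⟩, hwp⟩
    refine ⟨⟨by omega, hp⟩, fun h => ?_⟩
    have h0 := h.1
    have h1 : p + 1 ≤ ⌈w⌉₊ := by omega
    have h2 : ((p + 1 : ℕ) : ℝ) ≤ ⌈w⌉₊ := by exact_mod_cast h1
    have h3 : (⌈w⌉₊ : ℝ) < w + 1 := Nat.ceil_lt_add_one (by linarith)
    push_cast at h2
    linarith
  · rintro ⟨⟨hpz, hp⟩, hn⟩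
    refine ⟨⟨by omega, hp⟩, ?_⟩
    by_contra hlt
    push Not at hlt
    apply hn
    refine ⟨?_, hp⟩
    have : p < ⌈w⌉₊ := Nat.lt_ceil.mpr hlt
    omega

/-- `log w ≤ 2 log n` when `n ≥ 2`, `n ≥ w − 1`, `w ≥ 2` (`n² ≥ w`). [folklore] -/
private theorem log_le_two_mul_log {w n : ℝ} (hw : 2 ≤ w) (hn2 : 2 ≤ n) (hnw : w - 1 ≤ n) :
    Real.log w ≤ 2 * Real.log n := by
  have hsq : w ≤ n ^ 2 := by
    by_cases hw4 : w ≤ 4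
    · nlinarith
    · push Not at hw4; nlinarith
  calc Real.log w ≤ Real.log (n ^ 2) := Real.log_le_log (by linarith) hsq
    _ = 2 * Real.log n := by rw [Real.log_pow]; norm_num

set_option maxHeartbeats 400000 in
/-- **Window form of Mertens' theorem with rate.** If `|∑_{p ≤ x} a(p)/p − (log log x + c)| ≤ C/log x`
for all real `x ≥ 2` (`C ≥ 0`), then for all `2 ≤ w ≤ z`,
`∑_{w ≤ p < z} a(p)/p ≤ log log z − log log w + C₁/log w` with `C₁ = 4C + 2 + max(0, (c + log log 2) log 2)`
(difference of the estimates at `⌈z⌉ − 1` and `⌈w⌉ − 1`; `log w ≤ 2 log(⌈w⌉ − 1)` and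
`log log w − log log(⌈w⌉ − 1) ≤ 2/log w`; for `w = 2` the lower sum is empty). This is the step
from "Mertens by the prime ideal theorem" to `Ω(κ)` in Example 5.8 of the source.
[cite: DiamondHalberstamGalway2008, §1.4 (1.5) and §5.4 Example 5.8 (PDF p. 17, 52)] -/
theorem sum_window_le_of_mertens {a : ℕ → ℝ} {c C : ℝ} (hC0 : 0 ≤ C)
    (hM : ∀ x : ℝ, 2 ≤ x →
      |∑ p ∈ Nat.primesLE ⌊x⌋₊, a p / p - (Real.log (Real.log x) + c)| ≤ C / Real.log x) :
    ∃ C₁ : ℝ, 0 ≤ C₁ ∧ ∀ w z : ℝ, 2 ≤ w → w ≤ z →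
      ∑ p ∈ (Nat.primesBelow ⌈z⌉₊).filter (fun p : ℕ => w ≤ (p : ℝ)), a p / p ≤
        Real.log (Real.log z) - Real.log (Real.log w) + C₁ / Real.log w := by
  set C₁ : ℝ := 4 * C + 2 + max 0 ((c + Real.log (Real.log 2)) * Real.log 2) with hC₁
  refine ⟨C₁, by positivity, fun w z hw hwz => ?_⟩
  set S := (Nat.primesBelow ⌈z⌉₊).filter (fun p : ℕ => w ≤ (p : ℝ)) with hS
  have hlog2 : 0 < Real.log 2 := Real.log_pos one_lt_two
  have hlogw : 0 < Real.log w := Real.log_pos (by linarith)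
  have hlogz : 0 < Real.log z := Real.log_pos (by linarith)
  have hlog2w : Real.log 2 ≤ Real.log w := Real.log_le_log two_pos hw
  have hll : Real.log (Real.log w) ≤ Real.log (Real.log z) :=
    Real.log_le_log hlogw (Real.log_le_log (by linarith) hwz)
  have hC₁ge : 4 * C + 2 ≤ C₁ := by
    rw [hC₁]; linarith [le_max_left 0 ((c + Real.log (Real.log 2)) * Real.log 2)]
  have hC₁w : 0 ≤ C₁ / Real.log w := by positivity
  -- trivial case `z ≤ 2`: the window is empty
  by_cases hz2 : z ≤ 2
  · have hS0 : S = ∅ := by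
      rw [hS, Finset.filter_eq_empty_iff]
      intro p hp hwp
      rw [Nat.mem_primesBelow] at hp
      have h1 : ⌈z⌉₊ ≤ 2 := by
        have : ⌈z⌉₊ ≤ ⌈(2 : ℝ)⌉₊ := Nat.ceil_le_ceil hz2
        simpa using this
      have := hp.2.two_le
      omega
    rw [hS0, sum_empty]
    linarith
  push Not at hz2
  -- the sums `T(n)`
  set nz := ⌈z⌉₊ - 1 with hnz
  set nw := ⌈w⌉₊ - 1 with hnw
  have hnw1 : 1 ≤ ⌈w⌉₊ := Nat.one_le_ceil_iff.mpr (by linarith)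
  have hnz1 : 1 ≤ ⌈z⌉₊ := Nat.one_le_ceil_iff.mpr (by linarith)
  have hnwR : (nw : ℝ) = ⌈w⌉₊ - 1 := by rw [hnw]; push_cast [Nat.cast_sub hnw1]; ring
  have hnzR : (nz : ℝ) = ⌈z⌉₊ - 1 := by rw [hnz]; push_cast [Nat.cast_sub hnz1]; ring
  have hzceil : (z : ℝ) ≤ ⌈z⌉₊ := Nat.le_ceil z
  have hzceil' : (⌈z⌉₊ : ℝ) < z + 1 := Nat.ceil_lt_add_one (by linarith)
  have hwceil : (w : ℝ) ≤ ⌈w⌉₊ := Nat.le_ceil w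
  have hwceil' : (⌈w⌉₊ : ℝ) < w + 1 := Nat.ceil_lt_add_one (by linarith)
  have hnz_ge : z - 1 ≤ nz := by rw [hnzR]; linarith
  have hnz_lt : (nz : ℝ) < z := by rw [hnzR]; linarith
  have hnw_ge : w - 1 ≤ nw := by rw [hnwR]; linarith
  have hnw_lt : (nw : ℝ) < w := by rw [hnwR]; linarith
  have hsub : Nat.primesLE nw ⊆ Nat.primesLE nz := by
    intro p hp
    rw [Nat.mem_primesLE] at hp ⊢
    refine ⟨hp.1.trans ?_, hp.2⟩
    have : ⌈w⌉₊ ≤ ⌈z⌉₊ := Nat.ceil_le_ceil hwz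
    omega
  have hsumeq : ∑ p ∈ S, a p / p =
      ∑ p ∈ Nat.primesLE nz, a p / p - ∑ p ∈ Nat.primesLE nw, a p / p := by
    rw [hS, window_eq_sdiff (by linarith) hwz, Finset.sum_sdiff_eq_sub hsub]
  -- `nz ≥ 2` (as `z > 2`)
  have hnz2 : (2 : ℝ) ≤ nz := by
    have h3 : 3 ≤ ⌈z⌉₊ := Nat.lt_ceil.mpr (by push_cast; linarith)
    have : 2 ≤ nz := by omega
    exact_mod_cast this
  -- upper bound for `T(nz)`
  have hupper : ∑ p ∈ Nat.primesLE nz, a p / p ≤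
      Real.log (Real.log z) + c + 2 * C / Real.log w := by
    have h := hM nz hnz2
    rw [Nat.floor_natCast] at h
    have h2 := (abs_le.mp h).2
    have hlognz0 : 0 < Real.log nz := Real.log_pos (by linarith)
    have hlognz : Real.log (Real.log (nz : ℝ)) ≤ Real.log (Real.log z) :=
      Real.log_le_log hlognz0 (Real.log_le_log (by linarith) hnz_lt.le)
    have key := log_le_two_mul_log hw hnz2 (by linarith)
    have hCnz : C / Real.log nz ≤ 2 * C / Real.log w := by
      rw [div_le_div_iff₀ hlognz0 hlogw]; nlinarith
    linarith
  rw [hsumeq]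
  by_cases hnw2 : 2 ≤ nw
  · -- lower bound for `T(nw)`
    have hnw2R : (2 : ℝ) ≤ nw := by exact_mod_cast hnw2
    have h := hM nw hnw2R
    rw [Nat.floor_natCast] at h
    have h1 := (abs_le.mp h).1
    have hlognw0 : 0 < Real.log nw := Real.log_pos (by linarith)
    have key := log_le_two_mul_log hw hnw2R hnw_ge
    have hCnw : C / Real.log nw ≤ 2 * C / Real.log w := by
      rw [div_le_div_iff₀ hlognw0 hlogw]; nlinarith
    -- `log log w − log log nw ≤ 2/log w`
    have hgap : Real.log (Real.log w) - Real.log (Real.log nw) ≤ 2 / Real.log w := by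
      have hnw0 : (0 : ℝ) < nw := by linarith
      have h1' : Real.log (Real.log w) - Real.log (Real.log nw) ≤
          Real.log w / Real.log nw - 1 := by
        rw [← Real.log_div hlogw.ne' hlognw0.ne']
        linarith [Real.log_le_sub_one_of_pos (div_pos hlogw hlognw0)]
      have h2' : Real.log w / Real.log nw - 1 = (Real.log w - Real.log nw) / Real.log nw := by
        field_simp
      have h3' : Real.log w - Real.log nw ≤ 1 := by
        rw [← Real.log_div (by linarith) hnw0.ne']
        have : w / nw ≤ 2 := by
          rw [div_le_iff₀ hnw0]; linarith
        calc Real.log (w / nw) ≤ w / nw - 1 := Real.log_le_sub_one_of_pos (by positivity)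
          _ ≤ 1 := by linarith
      have h4' : (Real.log w - Real.log nw) / Real.log nw ≤ 1 / Real.log nw :=
        div_le_div_of_nonneg_right h3' hlognw0.le
      have h5' : 1 / Real.log nw ≤ 2 / Real.log w := by
        rw [div_le_div_iff₀ hlognw0 hlogw]; nlinarith
      linarith
    have e : (4 * C + 2) / Real.log w =
        2 * C / Real.log w + 2 * C / Real.log w + 2 / Real.log w := by ring
    have hmono : (4 * C + 2) / Real.log w ≤ C₁ / Real.log w :=
      div_le_div_of_nonneg_right hC₁ge hlogw.le
    linarith
  · -- `nw ≤ 1`: then `w = 2`, `T(nw) = 0`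
    push Not at hnw2
    have hT0 : ∑ p ∈ Nat.primesLE nw, a p / p = 0 := by
      refine sum_eq_zero fun p hp => ?_
      rw [Nat.mem_primesLE] at hp
      have := hp.2.two_le; omega
    have hw2 : w = 2 := by
      have : ⌈w⌉₊ ≤ 2 := by omega
      have : (⌈w⌉₊ : ℝ) ≤ 2 := by exact_mod_cast this
      linarith
    rw [hT0, sub_zero, hw2]
    have hmax : (c + Real.log (Real.log 2)) * Real.log 2 ≤ C₁ - 4 * C - 2 := by
      rw [hC₁]; linarith [le_max_right 0 ((c + Real.log (Real.log 2)) * Real.log 2)]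
    have hkey : c + Real.log (Real.log 2) + 2 * C / Real.log 2 ≤ C₁ / Real.log 2 := by
      have hnum : (c + Real.log (Real.log 2)) * Real.log 2 + 2 * C ≤ C₁ := by linarith
      calc c + Real.log (Real.log 2) + 2 * C / Real.log 2
          = ((c + Real.log (Real.log 2)) * Real.log 2 + 2 * C) / Real.log 2 := by
            field_simp
        _ ≤ C₁ / Real.log 2 := div_le_div_of_nonneg_right hnum hlog2.le
    rw [hw2] at hupper
    linarith

/-! ### Systems: the union bound and the window bound for `ω_f` -/

variable {k : ℕ}

/-- Union bound at a prime: `ω_f(p) ≤ ∑ᵢ ρᵢ(p)` (a root of `∏ fᵢ` modulo the prime `p` is a root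
of some `fᵢ`). [folklore] -/
private theorem polyRootCountMod_le_sum (f : Fin k → ℤ[X]) {p : ℕ} (hp : p.Prime) :
    polyRootCountMod f p ≤ ∑ i, polyRootCountMod ![f i] p := by
  classical
  have hset : (range p).filter (fun n : ℕ => (p : ℤ) ∣ ∏ i, (f i).eval (n : ℤ)) ⊆
      (univ : Finset (Fin k)).biUnion
        fun i => (range p).filter fun n : ℕ => (p : ℤ) ∣ (f i).eval (n : ℤ) := by
    intro n hn
    rw [mem_filter] at hn
    obtain ⟨hn, hdvd⟩ := hn
    rw [(Nat.prime_iff_prime_int.mp hp).dvd_finsetProd_iff] at hdvd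
    obtain ⟨i, -, hi⟩ := hdvd
    exact mem_biUnion.mpr ⟨i, mem_univ _, mem_filter.mpr ⟨hn, hi⟩⟩
  simp only [polyRootCountMod_single]
  unfold polyRootCountMod
  exact (card_le_card hset).trans card_biUnion_le

/-- A root of `fᵢ` modulo `p` is a root of `∏ⱼ fⱼ`: `ρᵢ(p) ≤ ω_f(p)`. [folklore] -/
private theorem polyRootCountMod_single_le' (f : Fin k → ℤ[X]) (i : Fin k) (p : ℕ) :
    polyRootCountMod ![f i] p ≤ polyRootCountMod f p := by
  rw [polyRootCountMod_single]
  unfold polyRootCountMod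
  refine card_le_card fun n hn => ?_
  rw [mem_filter] at hn ⊢
  exact ⟨hn.1, hn.2.trans (Finset.dvd_prod_of_mem (fun j => (f j).eval (n : ℤ)) (mem_univ i))⟩

/-- **Window bound for a Bateman–Horn system**: there is `C₁ = C₁(f) ≥ 0` with
`∑_{w ≤ p < z} ω_f(p)/p ≤ k (log log z − log log w) + C₁/log w` for all `2 ≤ w ≤ z`
(union bound `ω_f ≤ ∑ᵢ ρᵢ` and the one-polynomial window bounds).
[cite: DiamondHalberstamGalway2008, §5.4 Example 5.8 (PDF p. 52)] -/
theorem exists_sum_window_rootCount_le {f : Fin k → ℤ[X]} (hf : IsBatemanHornSystem f) :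
    ∃ C₁ : ℝ, 0 ≤ C₁ ∧ ∀ w z : ℝ, 2 ≤ w → w ≤ z →
      ∑ p ∈ (Nat.primesBelow ⌈z⌉₊).filter (fun p : ℕ => w ≤ (p : ℝ)),
          (polyRootCountMod f p : ℝ) / p ≤
        k * (Real.log (Real.log z) - Real.log (Real.log w)) + C₁ / Real.log w := by
  have hmem : ∀ i : Fin k, ∃ C₁ : ℝ, 0 ≤ C₁ ∧ ∀ w z : ℝ, 2 ≤ w → w ≤ z →
      ∑ p ∈ (Nat.primesBelow ⌈z⌉₊).filter (fun p : ℕ => w ≤ (p : ℝ)),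
          (polyRootCountMod ![f i] p : ℝ) / p ≤
        Real.log (Real.log z) - Real.log (Real.log w) + C₁ / Real.log w := by
    intro i
    obtain ⟨c, C, hC, hM⟩ := exists_mertens_rootCount (f i) (hf.irreducible i) (hf.natDegree_pos i)
    exact sum_window_le_of_mertens hC hM
  choose C hC0 hC using hmem
  refine ⟨∑ i, C i, sum_nonneg fun i _ => hC0 i, fun w z hw hwz => ?_⟩
  set S := (Nat.primesBelow ⌈z⌉₊).filter (fun p : ℕ => w ≤ (p : ℝ)) with hS
  have hprime : ∀ p ∈ S, p.Prime := fun p hp =>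
    (Nat.mem_primesBelow.mp (mem_filter.mp hp).1).2
  calc ∑ p ∈ S, (polyRootCountMod f p : ℝ) / p
      ≤ ∑ p ∈ S, ∑ i, (polyRootCountMod ![f i] p : ℝ) / p := by
        refine sum_le_sum fun p hp => ?_
        rw [← sum_div]
        refine div_le_div_of_nonneg_right ?_ (Nat.cast_nonneg _)
        exact_mod_cast polyRootCountMod_le_sum f (hprime p hp)
    _ = ∑ i, ∑ p ∈ S, (polyRootCountMod ![f i] p : ℝ) / p := sum_comm
    _ ≤ ∑ i : Fin k, (Real.log (Real.log z) - Real.log (Real.log w) + C i / Real.log w) :=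
        sum_le_sum fun i _ => hC i w z hw hwz
    _ = k * (Real.log (Real.log z) - Real.log (Real.log w)) + (∑ i, C i) / Real.log w := by
        rw [sum_add_distrib, sum_const, card_univ, Fintype.card_fin, nsmul_eq_mul, sum_div]

/-! ### The dimension statement -/

/-- `(1 − u)⁻¹ ≤ exp(u + 2u²)` for `u ≤ 1/2` (since `(1 − u)(1 + u + 2u²) = 1 + u²(1 − 2u) ≥ 1`).
[folklore] -/
private theorem inv_one_sub_le_exp {u : ℝ} (hu : u ≤ 1 / 2) :
    (1 - u)⁻¹ ≤ Real.exp (u + 2 * u ^ 2) := by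
  have h1u : 0 < 1 - u := by linarith
  rw [inv_eq_one_div, div_le_iff₀ h1u]
  have hsq : 0 ≤ u ^ 2 * (1 - 2 * u) := mul_nonneg (sq_nonneg u) (by linarith)
  calc (1 : ℝ) ≤ (1 + (u + 2 * u ^ 2)) * (1 - u) := by nlinarith
    _ ≤ Real.exp (u + 2 * u ^ 2) * (1 - u) :=
        mul_le_mul_of_nonneg_right (by linarith [Real.add_one_le_exp (u + 2 * u ^ 2)]) h1u.le

/-- `exp t ≤ 1 + t·exp t`. [folklore] -/
private theorem exp_le_one_add_mul_exp (t : ℝ) : Real.exp t ≤ 1 + t * Real.exp t := by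
  have h := Real.add_one_le_exp (-t)
  have hpos := Real.exp_pos t
  have h1 : (-t + 1) * Real.exp t ≤ Real.exp (-t) * Real.exp t :=
    mul_le_mul_of_nonneg_right h hpos.le
  rw [← Real.exp_add, neg_add_cancel, Real.exp_zero] at h1
  nlinarith

/-- **Every Bateman–Horn system is a sieve problem of dimension `k`** (Diamond–Halberstam–Galway
(1.5) with `κ = g`, Example 5.8: "and therefore `𝒜` satisfies `Ω(g)`"; Iwaniec's `Ω(κ, L)`): for a
Bateman–Horn system `f` of `k` polynomials the root density `p ↦ ω_f(p)/p` of `F = ∏ fᵢ` satisfies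
`0 ≤ ω_f(p)/p < 1` at every prime and, for some `L = L(f)` and all `2 ≤ w ≤ z`,
`∏_{w ≤ p < z} (1 − ω_f(p)/p)⁻¹ ≤ (log z/log w)^k (1 + L/log w)`. Proof: `ω_f(p) ≤ D = ∑ deg fᵢ` and
`ω_f(p) < p`; the primes `p ≤ 2D` contribute a factor `≤ (2D+1)^{2D+1}`, present only when
`w ≤ 2D`, i.e. `log w ≤ log(2D+1)`; for `p > 2D`, `(1 − ω/p)⁻¹ ≤ exp(ω/p + 2D²/p²)`, and
`∑_{w ≤ p < z} ω_f(p)/p ≤ k log(log z/log w) + C₁/log w`, `∑_{p ≥ w} 1/p² ≤ 2/w ≤ 2/log w`.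
[cite: DiamondHalberstamGalway2008, §1.4 Definition 1.3 (1.5) (PDF p. 17) and §5.4 Example 5.8 (PDF p. 52)] -/
theorem _root_.Literature.NumberTheory.Sieve.IsBatemanHornSystem.exists_hasIwaniecDimension
    {f : Fin k → ℤ[X]} (hf : IsBatemanHornSystem f) :
    ∃ L : ℝ, HasIwaniecDimension (rootDensity (∏ i, f i)) k L := by
  obtain ⟨C₁, hC₁0, hW⟩ := exists_sum_window_rootCount_le hf
  set D : ℕ := ∑ i, (f i).natDegree with hD
  set M : ℝ := ((2 * D + 1 : ℕ) : ℝ) with hM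
  have hM1 : 1 ≤ M := by rw [hM]; exact_mod_cast Nat.succ_le_succ (Nat.zero_le _)
  set B : ℝ := M ^ (2 * D + 1) with hB
  have hB1 : 1 ≤ B := one_le_pow₀ hM1
  set L₁ : ℝ := (B - 1) * Real.log M with hL₁
  have hL₁0 : 0 ≤ L₁ := mul_nonneg (by linarith) (Real.log_nonneg hM1)
  set C₂ : ℝ := C₁ + 4 * (D : ℝ) ^ 2 with hC₂
  have hC₂0 : 0 ≤ C₂ := by positivity
  set L₂ : ℝ := C₂ * Real.exp (C₂ / Real.log 2) with hL₂
  have hL₂0 : 0 ≤ L₂ := by positivity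
  have hlog2 : 0 < Real.log 2 := Real.log_pos one_lt_two
  refine ⟨L₁ + L₂ + L₁ * L₂ / Real.log 2, ⟨fun p hp => ?_, fun w z hw hwz => ?_⟩⟩
  · refine ⟨rootDensity_nonneg _ p, ?_⟩
    rw [rootDensity_apply, div_lt_one (by exact_mod_cast hp.pos),
      ← PolyPrimeCountBrun.polyRootCountMod_eq_single_prod]
    exact_mod_cast hf.hasNoFixedPrimeDivisor p hp
  set S := (Nat.primesBelow ⌈z⌉₊).filter (fun p : ℕ => w ≤ (p : ℝ)) with hS
  have hlogw : 0 < Real.log w := Real.log_pos (by linarith)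
  have hlogz : 0 < Real.log z := Real.log_pos (by linarith)
  have hlog2w : Real.log 2 ≤ Real.log w := Real.log_le_log two_pos hw
  have hprime : ∀ p ∈ S, p.Prime := fun p hp =>
    (Nat.mem_primesBelow.mp (mem_filter.mp hp).1).2
  have hwS : ∀ p ∈ S, w ≤ (p : ℝ) := fun p hp => (mem_filter.mp hp).2
  -- `ω(p) ≤ D` and `ω(p) + 1 ≤ p`
  have hωD : ∀ p : ℕ, p.Prime → (polyRootCountMod ![∏ i, f i] p : ℝ) ≤ D := by
    intro p hp
    rw [← PolyPrimeCountBrun.polyRootCountMod_eq_single_prod]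
    calc (polyRootCountMod f p : ℝ) ≤ ∑ i, (polyRootCountMod ![f i] p : ℝ) := by
          exact_mod_cast polyRootCountMod_le_sum f hp
      _ ≤ ∑ i, ((f i).natDegree : ℝ) := sum_le_sum fun i _ => by
          exact_mod_cast PolyPrimeCountBrun.polyRootCountMod_single_le_natDegree_of_lt hp
            ((polyRootCountMod_single_le' f i p).trans_lt (hf.hasNoFixedPrimeDivisor p hp))
      _ = D := by rw [hD]; push_cast; rfl
  have hωp : ∀ p : ℕ, p.Prime → (polyRootCountMod ![∏ i, f i] p : ℝ) + 1 ≤ p := by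
    intro p hp
    rw [← PolyPrimeCountBrun.polyRootCountMod_eq_single_prod]
    exact_mod_cast Nat.succ_le_of_lt (hf.hasNoFixedPrimeDivisor p hp)
  set E : ℕ → ℝ := fun p =>
    Real.exp ((polyRootCountMod ![∏ i, f i] p : ℝ) / p + 2 * (D : ℝ) ^ 2 * (1 / (p : ℝ) ^ 2))
    with hE
  -- termwise bound
  have hpt : ∀ p ∈ S, (1 - rootDensity (∏ i, f i) p)⁻¹ ≤ (if p ≤ 2 * D then M else 1) * E p := by
    intro p hp
    have hpp : p.Prime := hprime p hp
    have hp0 : (0 : ℝ) < p := by exact_mod_cast hpp.pos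
    have hE1 : 1 ≤ E p := Real.one_le_exp (by positivity)
    rw [rootDensity_apply]
    by_cases hpD : p ≤ 2 * D
    · rw [if_pos hpD]
      have h1 : 1 - (polyRootCountMod ![∏ i, f i] p : ℝ) / p =
          ((p : ℝ) - polyRootCountMod ![∏ i, f i] p) / p := by
        field_simp
      have hden : (1 : ℝ) ≤ (p : ℝ) - polyRootCountMod ![∏ i, f i] p := by
        linarith [hωp p hpp]
      calc (1 - (polyRootCountMod ![∏ i, f i] p : ℝ) / p)⁻¹
          = p / ((p : ℝ) - polyRootCountMod ![∏ i, f i] p) := by rw [h1, inv_div]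
        _ ≤ p := div_le_self hp0.le hden
        _ ≤ M := by rw [hM]; exact_mod_cast (by omega : p ≤ 2 * D + 1)
        _ ≤ M * E p := le_mul_of_one_le_right (by linarith) hE1
    · rw [if_neg hpD, one_mul]
      push Not at hpD
      set t : ℝ := (polyRootCountMod ![∏ i, f i] p : ℝ) / p with ht
      have ht0 : 0 ≤ t := by positivity
      have h2D : (2 * D : ℝ) < p := by exact_mod_cast hpD
      have hωD' := hωD p hpp
      have ht2 : t ≤ 1 / 2 := by
        rw [ht, div_le_iff₀ hp0]
        linarith
      have htD : t ≤ D * (1 / (p : ℝ)) := by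
        rw [ht, mul_one_div]
        exact div_le_div_of_nonneg_right hωD' hp0.le
      have htsq : t ^ 2 ≤ (D : ℝ) ^ 2 * (1 / (p : ℝ) ^ 2) := by
        calc t ^ 2 ≤ ((D : ℝ) * (1 / (p : ℝ))) ^ 2 := pow_le_pow_left₀ ht0 htD 2
          _ = (D : ℝ) ^ 2 * (1 / (p : ℝ) ^ 2) := by ring
      calc (1 - t)⁻¹ ≤ Real.exp (t + 2 * t ^ 2) := inv_one_sub_le_exp ht2
        _ ≤ E p := by
            simp only [hE]
            exact Real.exp_le_exp.mpr (by linarith)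
  have hnonneg : ∀ p ∈ S, 0 ≤ (1 - rootDensity (∏ i, f i) p)⁻¹ := fun p _ =>
    inv_nonneg.mpr (sub_nonneg.mpr (rootDensity_le_one _ _))
  -- the small primes: a factor `≤ 1 + L₁/log w`
  have hprodM : ∏ p ∈ S, (if p ≤ 2 * D then M else 1) ≤ 1 + L₁ / Real.log w := by
    rw [prod_ite, prod_const_one, mul_one, prod_const]
    by_cases hw2D : w ≤ 2 * (D : ℝ)
    · have hcard : #(S.filter fun p => p ≤ 2 * D) ≤ 2 * D + 1 := by
        calc #(S.filter fun p => p ≤ 2 * D) ≤ #(range (2 * D + 1)) :=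
              card_le_card fun p hp => by
                rw [mem_filter] at hp
                rw [mem_range]
                omega
          _ = 2 * D + 1 := card_range _
      have hMB : M ^ #(S.filter fun p => p ≤ 2 * D) ≤ B := pow_le_pow_right₀ hM1 hcard
      have hwM : w ≤ M := by
        rw [hM]; push_cast; linarith
      have hlogM : Real.log w ≤ Real.log M := Real.log_le_log (by linarith) hwM
      have hq : 1 ≤ Real.log M / Real.log w := by
        rw [le_div_iff₀ hlogw]; linarith
      calc M ^ #(S.filter fun p => p ≤ 2 * D) ≤ B := hMB
        _ = 1 + (B - 1) * 1 := by ring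
        _ ≤ 1 + (B - 1) * (Real.log M / Real.log w) := by gcongr
        _ = 1 + L₁ / Real.log w := by rw [hL₁]; ring
    · push Not at hw2D
      have hempty : S.filter (fun p => p ≤ 2 * D) = ∅ := by
        rw [filter_eq_empty_iff]
        intro p hp hple
        have h1 := hwS p hp
        have h2 : (p : ℝ) ≤ 2 * D := by exact_mod_cast hple
        linarith
      rw [hempty, card_empty, pow_zero]
      have : 0 ≤ L₁ / Real.log w := div_nonneg hL₁0 hlogw.le
      linarith
  -- the exponential factor
  have hprodE : ∏ p ∈ S, E p =
      Real.exp (∑ p ∈ S, (polyRootCountMod ![∏ i, f i] p : ℝ) / p +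
        2 * (D : ℝ) ^ 2 * ∑ p ∈ S, 1 / (p : ℝ) ^ 2) := by
    simp only [hE]
    rw [← Real.exp_sum, sum_add_distrib, mul_sum]
  have hsumω : ∑ p ∈ S, (polyRootCountMod ![∏ i, f i] p : ℝ) / p ≤
      k * (Real.log (Real.log z) - Real.log (Real.log w)) + C₁ / Real.log w := by
    have h := hW w z hw hwz
    calc ∑ p ∈ S, (polyRootCountMod ![∏ i, f i] p : ℝ) / p
        = ∑ p ∈ S, (polyRootCountMod f p : ℝ) / p :=
          sum_congr rfl fun p _ => by rw [← PolyPrimeCountBrun.polyRootCountMod_eq_single_prod]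
      _ ≤ _ := h
  have hsq : ∑ p ∈ S, 1 / (p : ℝ) ^ 2 ≤ 2 / w := by
    rw [hS]; exact sum_window_inv_sq_le (z := z) hw
  have hwlog : Real.log w ≤ w := (Real.log_le_sub_one_of_pos (by linarith)).trans (by linarith)
  have h4 : 2 * (D : ℝ) ^ 2 * ∑ p ∈ S, 1 / (p : ℝ) ^ 2 ≤ 4 * (D : ℝ) ^ 2 / Real.log w := by
    calc 2 * (D : ℝ) ^ 2 * ∑ p ∈ S, 1 / (p : ℝ) ^ 2 ≤ 2 * (D : ℝ) ^ 2 * (2 / w) := by gcongr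
      _ = 4 * (D : ℝ) ^ 2 / w := by ring
      _ ≤ 4 * (D : ℝ) ^ 2 / Real.log w :=
          div_le_div_of_nonneg_left (by positivity) hlogw hwlog
  set t : ℝ := C₂ / Real.log w with ht_def
  have ht0 : 0 ≤ t := by positivity
  have htle : t ≤ C₂ / Real.log 2 := div_le_div_of_nonneg_left hC₂0 hlog2 hlog2w
  have hexp_arg : ∑ p ∈ S, (polyRootCountMod ![∏ i, f i] p : ℝ) / p +
      2 * (D : ℝ) ^ 2 * ∑ p ∈ S, 1 / (p : ℝ) ^ 2 ≤
        k * (Real.log (Real.log z) - Real.log (Real.log w)) + t := by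
    have e : t = C₁ / Real.log w + 4 * (D : ℝ) ^ 2 / Real.log w := by
      rw [ht_def, hC₂]; ring
    linarith
  have hLL : Real.exp (Real.log (Real.log z) - Real.log (Real.log w)) = Real.log z / Real.log w := by
    rw [Real.exp_sub, Real.exp_log hlogz, Real.exp_log hlogw]
  have hk : Real.exp ((k : ℝ) * (Real.log (Real.log z) - Real.log (Real.log w))) =
      (Real.log z / Real.log w) ^ (k : ℝ) := by
    rw [Real.exp_nat_mul, hLL, Real.rpow_natCast]
  have hexp_t : Real.exp t ≤ 1 + L₂ / Real.log w := by
    calc Real.exp t ≤ 1 + t * Real.exp t := exp_le_one_add_mul_exp t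
      _ ≤ 1 + t * Real.exp (C₂ / Real.log 2) := by gcongr
      _ = 1 + L₂ / Real.log w := by rw [hL₂, ht_def]; ring
  have hLcomb : (1 + L₁ / Real.log w) * (1 + L₂ / Real.log w) ≤
      1 + (L₁ + L₂ + L₁ * L₂ / Real.log 2) / Real.log w := by
    have e1 : (1 + L₁ / Real.log w) * (1 + L₂ / Real.log w) =
        1 + (L₁ + L₂) / Real.log w + (L₁ * L₂ / Real.log w) / Real.log w := by
      field_simp
      ring
    have e2 : L₁ * L₂ / Real.log w ≤ L₁ * L₂ / Real.log 2 :=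
      div_le_div_of_nonneg_left (mul_nonneg hL₁0 hL₂0) hlog2 hlog2w
    have e3 : (L₁ * L₂ / Real.log w) / Real.log w ≤ (L₁ * L₂ / Real.log 2) / Real.log w :=
      div_le_div_of_nonneg_right e2 hlogw.le
    have e4 : 1 + (L₁ + L₂ + L₁ * L₂ / Real.log 2) / Real.log w =
        1 + (L₁ + L₂) / Real.log w + (L₁ * L₂ / Real.log 2) / Real.log w := by ring
    rw [e1, e4]
    linarith
  have hpos1 : 0 ≤ 1 + L₁ / Real.log w := by positivity
  calc ∏ p ∈ S, (1 - rootDensity (∏ i, f i) p)⁻¹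
      ≤ ∏ p ∈ S, ((if p ≤ 2 * D then M else 1) * E p) := prod_le_prod hnonneg hpt
    _ = (∏ p ∈ S, (if p ≤ 2 * D then M else 1)) * ∏ p ∈ S, E p := prod_mul_distrib
    _ ≤ (1 + L₁ / Real.log w) *
          Real.exp (k * (Real.log (Real.log z) - Real.log (Real.log w)) + t) := by
        refine mul_le_mul hprodM ?_ (prod_nonneg fun p _ => (Real.exp_pos _).le) hpos1
        rw [hprodE]
        exact Real.exp_le_exp.mpr hexp_arg
    _ = (Real.log z / Real.log w) ^ (k : ℝ) * ((1 + L₁ / Real.log w) * Real.exp t) := by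
        rw [Real.exp_add, hk]; ring
    _ ≤ (Real.log z / Real.log w) ^ (k : ℝ) * ((1 + L₁ / Real.log w) * (1 + L₂ / Real.log w)) := by
        gcongr
    _ ≤ (Real.log z / Real.log w) ^ (k : ℝ) * (1 + (L₁ + L₂ + L₁ * L₂ / Real.log 2) / Real.log w) := by
        gcongr

/-- The one-polynomial case: for `g ∈ ℤ[X]` with `![g]` a Bateman–Horn system (irreducible,
positive leading coefficient, no fixed prime divisor) the root density `p ↦ ρ_g(p)/p` is a sieve
density of dimension `1` in Iwaniec's sense `Ω(1, L)` for some `L = L(g)`.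
[cite: DiamondHalberstamGalway2008, §1.4 Definition 1.3 (1.5) (PDF p. 17) and §5.4 Example 5.8 (PDF p. 52)] -/
theorem _root_.Literature.NumberTheory.Sieve.IsBatemanHornSystem.exists_hasIwaniecDimension_single
    {g : ℤ[X]} (hg : IsBatemanHornSystem ![g]) :
    ∃ L : ℝ, HasIwaniecDimension (rootDensity g) 1 L := by
  obtain ⟨L, hL⟩ := hg.exists_hasIwaniecDimension
  refine ⟨L, ?_⟩
  have e : (∏ i, (![g] : Fin 1 → ℤ[X]) i) = g := by simp
  rw [e] at hL
  simpa using hL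

end BatemanHornDimension

end Literature.NumberTheory.Sieve
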